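import Mathlib.Analysis.Complex.Basic
import Mathlib.Algebra.BigOperators.Fin
import Mathlib.Data.Fin.Tuple.Basic
import Mathlib.Order.Fin.Basic
import Literature.Computability.QuantumComplexity.TreeProductFrames
import HarnessLib

/-!
# Adaptive LOCC-tree measurements gain nothing on tensor products of two-qubit functionals

A potential (dynamic-programming) bound for the tree-frame value of PAIR-STRUCTURED operators on
`n` qubits, used to show that the tree-frame support function is multiplicative on tensor powers of a
two-qubit functional (route `QuantumAdvantage/SeparableFrames`, refutation of the crux
`FrameDilationPolynomial`: the SEP-vs-tree dilation constant `κₙ` grows exponentially).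

## The statement (`IsTreeProductBasis.sum_norm_pairForm_le`)

Fix a two-qubit kernel `G s t s' t'` (the entries `⟨s t| G |s' t'⟩` of an operator on `ℂ² ⊗ ℂ²`,
symmetric under swapping the two qubits), a real potential `F` on single-qubit vectors and a real
`Q ≥ 0` such that for every orthonormal qubit basis `u` and unit vector `α`
* `∑_b F(u_b) ≤ Q²`, and
* `∑_b |⟨u_b| G_α |u_b⟩| ≤ F(α)`, where `G_α = (⟨α| ⊗ 1) G (|α⟩ ⊗ 1)` is `G` with its first qubit
  contracted against `α`.
A *pair configuration* on the wires `Fin n` marks each wire either as HALF (`h j = true`, carrying a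
unit vector `a j`: its partner was already measured with outcome vector `a j`) or as PAIRED with a
distinct wire `σ j` (a fixed-point-free involution on the paired wires). Its operator has entries
`M z z' = ∏_{half j} G_{a j}(z j, z' j) · ∏_{pairs j < σ j} G((z j, z (σ j)), (z' j, z' (σ j)))`, its
potential is `∏_{half j} F(a j) · Q^{#paired}`.  THEOREM: for every LOCC-tree orthonormal product
basis `e` of `n` qubits (`IsTreeProductBasis`), `∑_y |⟨e_y| M |e_y⟩| ≤ potential`.
Proof: induction along the tree; measuring the first wire `i` in the basis `u` changes only the
factor of the block containing `i` (`F(a i) → |⟨u_b|G_{a i}|u_b⟩|`, summing to `≤ F(a i)`, or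
`Q · Q → F(u_b)`, summing to `≤ Q²`) and leaves a pair configuration on the remaining wires.
Corollary (file `FrameDilationGadget`): for `G = W = 1 - |χ⟩⟨χ|`, `χ = 2|00⟩ + |11⟩`, `F(α) =
4|α₀|² + |α₁|²`, `Q = √5`, the tree value of `W^{⊗m}` is `≤ 5^m` — adaptive trees interleaving the
copies gain nothing over product trees.

Design: theorem-only file (no new definitions): the configuration operator and potential are written
inline; `exists_succAbove_lift` re-indexes partner maps after a wire is removed (`Fin.succAbove`).
Elementary; no source beyond the definitions of `TreeProductFrames` (the bodies of
Matthews–Wehner–Winter, arXiv:0810.2327, for context only).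
-/

open scoped BigOperators

namespace Literature.Computability.QuantumComplexity

open Literature.Computability.Cryptography (QReg)

/-- Re-indexing a map into the wires `≠ i` of `n + 1` wires through `Fin.succAbove i`: if `g k ≠ i`
for all `k` then `g = i.succAbove ∘ g'` for some `g'`. [folklore] -/
theorem exists_succAbove_lift {n : ℕ} (i : Fin (n + 1)) (g : Fin n → Fin (n + 1))
    (hg : ∀ k, g k ≠ i) : ∃ g' : Fin n → Fin n, ∀ k, i.succAbove (g' k) = g k :=
  ⟨fun k => (Fin.exists_succAbove_eq (hg k)).choose,
    fun k => (Fin.exists_succAbove_eq (hg k)).choose_spec⟩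

/-- A four-fold sum of products `c s s' * d w w'` factors as the product of the two double sums.
[folklore] -/
theorem sum_sum_sum_sum_mul_eq {ι κ : Type*} [Fintype ι] [Fintype κ] (c : ι → ι → ℂ)
    (d : κ → κ → ℂ) :
    ∑ s, ∑ w, ∑ s', ∑ w', c s s' * d w w' = (∑ s, ∑ s', c s s') * ∑ w, ∑ w', d w w' := by
  rw [Finset.sum_mul_sum]
  refine Finset.sum_congr rfl fun s _ => Finset.sum_congr rfl fun w _ => ?_
  rw [Finset.sum_mul_sum]

/-- Reordering a four-fold sum: `∑_s ∑_w ∑_s' ∑_w' = ∑_w ∑_w' ∑_s ∑_s'`. [folklore] -/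
theorem sum_four_comm {ι κ : Type*} [Fintype ι] [Fintype κ] {M : Type*} [AddCommMonoid M]
    (c : ι → ι → κ → κ → M) :
    ∑ s, ∑ w, ∑ s', ∑ w', c s s' w w' = ∑ w, ∑ w', ∑ s, ∑ s', c s s' w w' := by
  have h1 : ∀ s w, ∑ s', ∑ w', c s s' w w' = ∑ w', ∑ s', c s s' w w' := fun s w =>
    Finset.sum_comm
  simp_rw [h1]
  rw [Finset.sum_comm]
  refine Finset.sum_congr rfl fun w _ => ?_
  rw [Finset.sum_comm]

/-- **Potential bound for pair-structured functionals under LOCC-tree measurements.**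
For a swap-symmetric two-qubit kernel `G`, a potential `F` and `Q ≥ 0` with `∑_b F(u_b) ≤ Q²` on
orthonormal bases and `∑_b |⟨u_b|G_α|u_b⟩| ≤ F(α)` for unit `α` (where
`G_α t t' = ∑_{s s'} conj(α s) G s t s' t' α s'`), every pair configuration `(σ, h, a)` on `n` wires
(half wires `h j = true` carry unit vectors `a j`; paired wires are matched by the fixed-point-free
involution `σ`) and every LOCC-tree orthonormal product basis `e` satisfy
`∑_y |⟨e_y| M_{σ,h,a} |e_y⟩| ≤ ∏_j (F(a j) if half, Q if paired)`, with
`M z z' = ∏_j (G_{a j}(z j, z' j) if half; G((z j, z σj),(z' j, z' σj)) if j < σ j; 1 otherwise)`.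
In words: adaptive (interleaved, feed-forward) tree measurements of a tensor product of two-qubit
blocks are bounded by the product of the single-block potentials. [folklore] -/
theorem IsTreeProductBasis.sum_norm_pairForm_le
    (G : Bool → Bool → Bool → Bool → ℂ) (hG : ∀ s t s' t', G s t s' t' = G t s t' s')
    (F : (Bool → ℂ) → ℝ) (Q : ℝ) (hQ : 0 ≤ Q)
    (hFQ : ∀ u : Bool → Bool → ℂ, IsQubitONB u → ∑ b, F (u b) ≤ Q * Q)
    (hGF : ∀ (α : Bool → ℂ) (u : Bool → Bool → ℂ), ∑ t, star (α t) * α t = 1 → IsQubitONB u →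
      ∑ b, ‖∑ t, ∑ t', star (u b t) * (∑ s, ∑ s', star (α s) * G s t s' t' * α s') * u b t'‖ ≤
        F α) :
    ∀ (n : ℕ) (e : QReg n → QReg n → ℂ), IsTreeProductBasis n e →
      ∀ (σ : Fin n → Fin n) (h : Fin n → Bool) (a : Fin n → Bool → ℂ),
        (∀ j, h j = false → σ j ≠ j ∧ σ (σ j) = j ∧ h (σ j) = false) →
        (∀ j, h j = true → ∑ t, star (a j t) * a j t = 1) →
        ∑ y, ‖∑ z, ∑ z', star (e y z) *
            (∏ j, (if h j = true then ∑ s, ∑ s', star (a j s) * G s (z j) s' (z' j) * a j s'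
              else if j < σ j then G (z j) (z (σ j)) (z' j) (z' (σ j)) else 1)) * e y z'‖ ≤
          ∏ j, (if h j = true then F (a j) else Q) := by
  have hF0 : ∀ α : Bool → ℂ, ∑ t, star (α t) * α t = 1 → 0 ≤ F α := fun α hα =>
    le_trans (Finset.sum_nonneg fun _ _ => norm_nonneg _) (hGF α _ hα isQubitONB_std)
  have hpot0 : ∀ (m : ℕ) (h₁ : Fin m → Bool) (a₁ : Fin m → Bool → ℂ),
      (∀ j, h₁ j = true → ∑ t, star (a₁ j t) * a₁ j t = 1) →
      ∀ s : Finset (Fin m), 0 ≤ ∏ j ∈ s, (if h₁ j = true then F (a₁ j) else Q) :=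
    fun m h₁ a₁ ha₁ s => Finset.prod_nonneg fun j _ => by
      by_cases hj : h₁ j = true
      · rw [if_pos hj]; exact hF0 _ (ha₁ j hj)
      · rw [if_neg hj]; exact hQ
  intro n
  induction n with
  | zero =>
    intro e he σ h a _ _
    have he1 : ∀ y z, e y z = 1 := he
    simp [he1]
  | succ n ih =>
    intro e he σ h a hσ ha
    obtain ⟨i, u, f, hu, hf, he⟩ := he
    have hunit : ∀ b, ∑ t, star (u b t) * u b t = 1 := fun b => by simpa using hu b b
    -- name the configuration operator
    set P : QReg (n + 1) → QReg (n + 1) → ℂ := fun z z' =>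
      ∏ j, (if h j = true then ∑ s, ∑ s', star (a j s) * G s (z j) s' (z' j) * a j s'
        else if j < σ j then G (z j) (z (σ j)) (z' j) (z' (σ j)) else 1) with hP
    change ∑ y, ‖∑ z, ∑ z', star (e y z) * P z z' * e y z'‖ ≤ _
    -- split the label `y` along the first measured wire `i` and rewrite the basis vectors
    rw [sum_qreg_succ_split i]
    simp only [he, Fin.insertNth_apply_same, Fin.removeNth_insertNth]
    cases hi : h i with
    | true =>
      /- HALF wire `i` (its partner was measured earlier with outcome vector `a i`). -/
      obtain ⟨σ', hσ'⟩ := exists_succAbove_lift i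
        (fun k => if h (i.succAbove k) = true then i.succAbove k else σ (i.succAbove k))
        (fun k => by
          by_cases hk : h (i.succAbove k) = true
          · rw [if_pos hk]; exact Fin.succAbove_ne i k
          · rw [if_neg hk]
            intro hki
            have hk' : h (i.succAbove k) = false := by simpa using hk
            have := (hσ _ hk').2.2
            rw [hki, hi] at this
            exact Bool.noConfusion this)
      have hσ'eq : ∀ k, h (i.succAbove k) = false → i.succAbove (σ' k) = σ (i.succAbove k) := by
        intro k hk
        have := hσ' k
        simpa [hk] using this
      have hσ'v : ∀ k, (fun k => h (i.succAbove k)) k = false →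
          σ' k ≠ k ∧ σ' (σ' k) = k ∧ (fun k => h (i.succAbove k)) (σ' k) = false := by
        intro k hk
        simp only at hk ⊢
        obtain ⟨h1, h2, h3⟩ := hσ _ hk
        have e1 := hσ'eq k hk
        have hk3 : h (i.succAbove (σ' k)) = false := by rw [e1]; exact h3
        refine ⟨fun hkk => h1 ?_, ?_, hk3⟩
        · rw [← e1, hkk]
        · apply Fin.succAbove_right_injective (p := i)
          rw [hσ'eq _ hk3, e1, h2]
      have ha'v : ∀ k, (fun k => h (i.succAbove k)) k = true →
          ∑ t, star ((fun k => a (i.succAbove k)) k t) * (fun k => a (i.succAbove k)) k t = 1 :=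
        fun k hk => ha _ hk
      -- the configuration operator of the remaining wires
      set P' : QReg n → QReg n → ℂ := fun w w' =>
        ∏ k, (if h (i.succAbove k) = true then
            ∑ s, ∑ s', star (a (i.succAbove k) s) * G s (w k) s' (w' k) * a (i.succAbove k) s'
          else if k < σ' k then G (w k) (w (σ' k)) (w' k) (w' (σ' k)) else 1) with hP'
      have hIH : ∀ b, ∑ y', ‖∑ w, ∑ w', star (f b y' w) * P' w w' * f b y' w'‖ ≤
          ∏ k, (if h (i.succAbove k) = true then F (a (i.succAbove k)) else Q) := fun b => by
        have := ih (f b) (hf b) σ' (fun k => h (i.succAbove k)) (fun k => a (i.succAbove k))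
          hσ'v ha'v
        simpa only [hP'] using this
      -- entrywise factorisation of `P` along wire `i`
      have key : ∀ (s s' : Bool) (w w' : QReg n),
          P (Fin.insertNth i s w) (Fin.insertNth i s' w') =
            (∑ s₀, ∑ s₀', star (a i s₀) * G s₀ s s₀' s' * a i s₀') * P' w w' := by
        intro s s' w w'
        simp only [hP, hP']
        rw [Fin.prod_univ_succAbove _ i]
        simp only [Fin.insertNth_apply_same, Fin.insertNth_apply_succAbove, hi, if_true]
        congr 1
        refine Finset.prod_congr rfl fun k _ => ?_
        by_cases hk : h (i.succAbove k) = true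
        · simp only [hk, if_true]
        · have hk' : h (i.succAbove k) = false := by simpa using hk
          have e1 : σ (i.succAbove k) = i.succAbove (σ' k) := (hσ'eq k hk').symm
          simp only [hk', e1, Fin.insertNth_apply_succAbove, Fin.succAbove_lt_succAbove_iff]
      -- the quadratic form factorises
      have hqf : ∀ (b : Bool) (y' : QReg n),
          ‖∑ z, ∑ z', star (u b (z i) * f b y' (Fin.removeNth i z)) * P z z' *
              (u b (z' i) * f b y' (Fin.removeNth i z'))‖ =
            ‖∑ t, ∑ t', star (u b t) * (∑ s₀, ∑ s₀', star (a i s₀) * G s₀ t s₀' t' * a i s₀') *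
                u b t'‖ * ‖∑ w, ∑ w', star (f b y' w) * P' w w' * f b y' w'‖ := by
        intro b y'
        rw [sum_qreg_succ_split i]
        simp only [Fin.insertNth_apply_same, Fin.removeNth_insertNth]
        simp only [sum_qreg_succ_split i, Fin.insertNth_apply_same, Fin.removeNth_insertNth]
        rw [← norm_mul, ← sum_sum_sum_sum_mul_eq]
        congr 1
        refine Finset.sum_congr rfl fun s _ => Finset.sum_congr rfl fun w _ =>
          Finset.sum_congr rfl fun s' _ => Finset.sum_congr rfl fun w' _ => ?_
        rw [key, star_mul']
        ring
      have hpot' := hpot0 n (fun k => h (i.succAbove k)) (fun k => a (i.succAbove k)) ha'v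
        Finset.univ
      calc ∑ b, ∑ y', ‖∑ z, ∑ z', star (u b (z i) * f b y' (Fin.removeNth i z)) * P z z' *
              (u b (z' i) * f b y' (Fin.removeNth i z'))‖
          = ∑ b, ‖∑ t, ∑ t', star (u b t) *
                (∑ s₀, ∑ s₀', star (a i s₀) * G s₀ t s₀' t' * a i s₀') * u b t'‖ *
              ∑ y', ‖∑ w, ∑ w', star (f b y' w) * P' w w' * f b y' w'‖ := by
            refine Finset.sum_congr rfl fun b _ => ?_
            rw [Finset.mul_sum]
            exact Finset.sum_congr rfl fun y' _ => hqf b y'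
        _ ≤ ∑ b, ‖∑ t, ∑ t', star (u b t) *
                (∑ s₀, ∑ s₀', star (a i s₀) * G s₀ t s₀' t' * a i s₀') * u b t'‖ *
              ∏ k, (if h (i.succAbove k) = true then F (a (i.succAbove k)) else Q) :=
            Finset.sum_le_sum fun b _ => mul_le_mul_of_nonneg_left (hIH b) (norm_nonneg _)
        _ = (∑ b, ‖∑ t, ∑ t', star (u b t) *
                (∑ s₀, ∑ s₀', star (a i s₀) * G s₀ t s₀' t' * a i s₀') * u b t'‖) *
              ∏ k, (if h (i.succAbove k) = true then F (a (i.succAbove k)) else Q) :=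
            (Finset.sum_mul _ _ _).symm
        _ ≤ F (a i) * ∏ k, (if h (i.succAbove k) = true then F (a (i.succAbove k)) else Q) :=
            mul_le_mul_of_nonneg_right (hGF (a i) u (ha i hi) hu) hpot'
        _ = ∏ j, (if h j = true then F (a j) else Q) := by
            rw [Fin.prod_univ_succAbove _ i, if_pos hi]
    | false =>
      /- PAIRED wire `i`, partner `σ i ≠ i` sitting at position `k₀` among the remaining wires. -/
      obtain ⟨hii, hσσ, hhi⟩ := hσ i hi
      obtain ⟨k₀, hk₀⟩ := Fin.exists_succAbove_eq hii
      -- hk₀ : i.succAbove k₀ = σ i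
      obtain ⟨σ', hσ'⟩ := exists_succAbove_lift i
        (fun k => if k = k₀ then i.succAbove k else
          if h (i.succAbove k) = true then i.succAbove k else σ (i.succAbove k))
        (fun k => by
          by_cases hk0 : k = k₀
          · rw [if_pos hk0]; exact Fin.succAbove_ne i k
          · rw [if_neg hk0]
            by_cases hk : h (i.succAbove k) = true
            · rw [if_pos hk]; exact Fin.succAbove_ne i k
            · rw [if_neg hk]
              intro hki
              have hk' : h (i.succAbove k) = false := by simpa using hk
              have h2 := (hσ _ hk').2.1
              rw [hki, ← hk₀] at h2
              exact hk0 (Fin.succAbove_right_injective (p := i) h2.symm))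
      have hσ'eq : ∀ k, k ≠ k₀ → h (i.succAbove k) = false →
          i.succAbove (σ' k) = σ (i.succAbove k) := by
        intro k hk0 hk
        have := hσ' k
        simpa [hk0, hk] using this
      -- the new configuration: wire `k₀` becomes a half wire carrying the outcome vector `u b`
      have hσ'v : ∀ k, (fun k => if k = k₀ then true else h (i.succAbove k)) k = false →
          σ' k ≠ k ∧ σ' (σ' k) = k ∧
            (fun k => if k = k₀ then true else h (i.succAbove k)) (σ' k) = false := by
        intro k hk
        simp only at hk ⊢
        by_cases hk0 : k = k₀
        · simp [hk0] at hk
        rw [if_neg hk0] at hk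
        obtain ⟨h1, h2, h3⟩ := hσ _ hk
        have e1 := hσ'eq k hk0 hk
        have hne : σ' k ≠ k₀ := by
          intro heq
          rw [heq, hk₀] at e1
          have : σ (σ i) = σ (σ (i.succAbove k)) := by rw [e1]
          rw [hσσ, h2] at this
          exact Fin.succAbove_ne i k this.symm
        have hk3 : h (i.succAbove (σ' k)) = false := by rw [e1]; exact h3
        refine ⟨fun hkk => h1 ?_, ?_, by rw [if_neg hne]; exact hk3⟩
        · rw [← e1, hkk]
        · apply Fin.succAbove_right_injective (p := i)
          rw [hσ'eq _ hne hk3, e1, h2]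
      have ha'v : ∀ (b : Bool) (k : Fin n),
          (fun k => if k = k₀ then true else h (i.succAbove k)) k = true →
          ∑ t, star ((fun k => if k = k₀ then u b else a (i.succAbove k)) k t) *
            (fun k => if k = k₀ then u b else a (i.succAbove k)) k t = 1 := by
        intro b k hk
        simp only at hk ⊢
        by_cases hk0 : k = k₀
        · simp only [hk0, if_true]; exact hunit b
        · rw [if_neg hk0] at hk ⊢; exact ha _ hk
      -- configuration operator of the remaining wires (depends on the outcome `b` through `u b`)
      set P' : Bool → QReg n → QReg n → ℂ := fun b w w' =>
        ∏ k, (if (if k = k₀ then true else h (i.succAbove k)) = true then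
            ∑ s, ∑ s', star ((if k = k₀ then u b else a (i.succAbove k)) s) * G s (w k) s' (w' k) *
              (if k = k₀ then u b else a (i.succAbove k)) s'
          else if k < σ' k then G (w k) (w (σ' k)) (w' k) (w' (σ' k)) else 1) with hP'
      have hIH : ∀ b, ∑ y', ‖∑ w, ∑ w', star (f b y' w) * P' b w w' * f b y' w'‖ ≤
          ∏ k, (if (if k = k₀ then true else h (i.succAbove k)) = true then
            F (if k = k₀ then u b else a (i.succAbove k)) else Q) := fun b => by
        have := ih (f b) (hf b) σ' (fun k => if k = k₀ then true else h (i.succAbove k))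
          (fun k => if k = k₀ then u b else a (i.succAbove k)) hσ'v (ha'v b)
        simpa only [hP'] using this
      -- the `b`-independent factors of the remaining wires other than `k₀`
      set R : QReg n → QReg n → ℂ := fun w w' =>
        ∏ k ∈ Finset.univ.erase k₀, (if h (i.succAbove k) = true then
            ∑ s, ∑ s', star (a (i.succAbove k) s) * G s (w k) s' (w' k) * a (i.succAbove k) s'
          else if k < σ' k then G (w k) (w (σ' k)) (w' k) (w' (σ' k)) else 1) with hR
      have hfac : ∀ (s s' : Bool) (w w' : QReg n), ∀ k ∈ Finset.univ.erase k₀,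
          (fun z z' : QReg (n + 1) => (if h (i.succAbove k) = true then
              ∑ s₀, ∑ s₀', star (a (i.succAbove k) s₀) *
                G s₀ (z (i.succAbove k)) s₀' (z' (i.succAbove k)) * a (i.succAbove k) s₀'
            else if i.succAbove k < σ (i.succAbove k) then
              G (z (i.succAbove k)) (z (σ (i.succAbove k))) (z' (i.succAbove k))
                (z' (σ (i.succAbove k)))
            else 1)) (Fin.insertNth i s w) (Fin.insertNth i s' w') =
          (if h (i.succAbove k) = true then
              ∑ s₀, ∑ s₀', star (a (i.succAbove k) s₀) * G s₀ (w k) s₀' (w' k) *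
                a (i.succAbove k) s₀'
            else if k < σ' k then G (w k) (w (σ' k)) (w' k) (w' (σ' k)) else 1) := by
        intro s s' w w' k hk
        have hk0 : k ≠ k₀ := Finset.ne_of_mem_erase hk
        simp only [Fin.insertNth_apply_succAbove]
        by_cases hk : h (i.succAbove k) = true
        · simp only [hk, if_true]
        · have hk' : h (i.succAbove k) = false := by simpa using hk
          have e1 : σ (i.succAbove k) = i.succAbove (σ' k) := (hσ'eq k hk0 hk').symm
          simp only [hk', e1, Fin.insertNth_apply_succAbove, Fin.succAbove_lt_succAbove_iff]
      have key : ∀ (s s' : Bool) (w w' : QReg n),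
          P (Fin.insertNth i s w) (Fin.insertNth i s' w') = G s (w k₀) s' (w' k₀) * R w w' := by
        intro s s' w w'
        simp only [hP, hR]
        rw [Fin.prod_univ_succAbove _ i, ← Finset.mul_prod_erase _ _ (Finset.mem_univ k₀),
          ← mul_assoc]
        congr 1
        · -- the two factors of the pair `{i, σ i}` combine to `G s (w k₀) s' (w' k₀)`
          have hA : σ (i.succAbove k₀) = i := by rw [hk₀, hσσ]
          have hB : h (i.succAbove k₀) = false := by rw [hk₀]; exact hhi
          simp only [hi, hB, hA, Fin.insertNth_apply_same, ← hk₀, Fin.insertNth_apply_succAbove,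
            Bool.false_eq_true, if_false]
          rcases lt_or_gt_of_ne hii with hlt | hgt
          · have h1 : ¬ i < σ i := not_lt.mpr hlt.le
            rw [← hk₀] at hlt h1
            rw [if_neg h1, if_pos hlt, one_mul]
            exact hG _ _ _ _
          · have h1 : ¬ σ i < i := not_lt.mpr hgt.le
            rw [← hk₀] at hgt h1
            rw [if_pos hgt, if_neg h1, mul_one]
        · exact Finset.prod_congr rfl (hfac s s' w w')
      have hP'split : ∀ (b : Bool) (w w' : QReg n),
          P' b w w' = (∑ s, ∑ s', star (u b s) * G s (w k₀) s' (w' k₀) * u b s') * R w w' := by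
        intro b w w'
        simp only [hP', hR]
        rw [← Finset.mul_prod_erase _ _ (Finset.mem_univ k₀)]
        simp only [if_true]
        congr 1
        refine Finset.prod_congr rfl fun k hk => ?_
        have hk0 : k ≠ k₀ := Finset.ne_of_mem_erase hk
        simp only [hk0, if_false]
      -- the quadratic form of a leaf equals the quadratic form of the sub-leaf for `P' b`
      have hqf : ∀ (b : Bool) (y' : QReg n),
          ∑ z, ∑ z', star (u b (z i) * f b y' (Fin.removeNth i z)) * P z z' *
              (u b (z' i) * f b y' (Fin.removeNth i z')) =
            ∑ w, ∑ w', star (f b y' w) * P' b w w' * f b y' w' := by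
        intro b y'
        rw [sum_qreg_succ_split i]
        simp only [Fin.insertNth_apply_same, Fin.removeNth_insertNth]
        simp only [sum_qreg_succ_split i, Fin.insertNth_apply_same, Fin.removeNth_insertNth]
        simp only [key]
        rw [sum_four_comm]
        refine Finset.sum_congr rfl fun w _ => Finset.sum_congr rfl fun w' _ => ?_
        rw [hP'split]
        simp only [Finset.mul_sum, Finset.sum_mul]
        refine Finset.sum_congr rfl fun s _ => Finset.sum_congr rfl fun s' _ => ?_
        rw [star_mul']
        ring
      have hpotsplit : ∀ b : Bool,
          ∏ k, (if (if k = k₀ then true else h (i.succAbove k)) = true then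
              F (if k = k₀ then u b else a (i.succAbove k)) else Q) =
            F (u b) * ∏ k ∈ Finset.univ.erase k₀,
              (if h (i.succAbove k) = true then F (a (i.succAbove k)) else Q) := by
        intro b
        rw [← Finset.mul_prod_erase _ _ (Finset.mem_univ k₀)]
        simp only [if_true]
        congr 1
        refine Finset.prod_congr rfl fun k hk => ?_
        have hk0 : k ≠ k₀ := Finset.ne_of_mem_erase hk
        simp only [hk0, if_false]
      have hRpot := hpot0 n (fun k => h (i.succAbove k)) (fun k => a (i.succAbove k))
        (fun k hk => ha _ hk) (Finset.univ.erase k₀)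
      calc ∑ b, ∑ y', ‖∑ z, ∑ z', star (u b (z i) * f b y' (Fin.removeNth i z)) * P z z' *
              (u b (z' i) * f b y' (Fin.removeNth i z'))‖
          = ∑ b, ∑ y', ‖∑ w, ∑ w', star (f b y' w) * P' b w w' * f b y' w'‖ := by
            refine Finset.sum_congr rfl fun b _ => Finset.sum_congr rfl fun y' _ => ?_
            rw [hqf]
        _ ≤ ∑ b, F (u b) * ∏ k ∈ Finset.univ.erase k₀,
              (if h (i.succAbove k) = true then F (a (i.succAbove k)) else Q) :=
            Finset.sum_le_sum fun b _ => (hIH b).trans (le_of_eq (hpotsplit b))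
        _ = (∑ b, F (u b)) * ∏ k ∈ Finset.univ.erase k₀,
              (if h (i.succAbove k) = true then F (a (i.succAbove k)) else Q) :=
            (Finset.sum_mul _ _ _).symm
        _ ≤ Q * Q * ∏ k ∈ Finset.univ.erase k₀,
              (if h (i.succAbove k) = true then F (a (i.succAbove k)) else Q) :=
            mul_le_mul_of_nonneg_right (hFQ u hu) hRpot
        _ = ∏ j, (if h j = true then F (a j) else Q) := by
            rw [Fin.prod_univ_succAbove _ i, ← Finset.mul_prod_erase _ _ (Finset.mem_univ k₀),
              hk₀, hi, hhi]
            simp only [Bool.false_eq_true, if_false]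
            ring

end Literature.Computability.QuantumComplexity
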